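import Summits.QuantumFields.BalabanUV.T4Continuum.Support.NE3CurvedFrameKill
import Summits.QuantumFields.BalabanUV.T4Continuum.Support.NE3QuadRemainderTower
import Summits.QuantumFields.BalabanUV.T4Continuum.Support.NE3ResidualSliceRep
import Summits.QuantumFields.BalabanUV.T4Continuum.Support.NE3PureGaugeFirstVariation
import Summits.QuantumFields.BalabanUV.T4Continuum.Support.NE7TangentTransportGauge
import Summits.QuantumFields.BalabanUV.T4Continuum.Support.NE7FlatSliceStraightReduction
import Summits.QuantumFields.BalabanUV.T4Continuum.Support.NE3CpushGaugeCovariance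
import Summits.QuantumFields.BalabanUV.T4Continuum.Support.AveragingDeficitNearIdentity
import Summits.QuantumFields.BalabanUV.T4Continuum.Support.AveragingDeficitTransport
import Summits.QuantumFields.BalabanUV.T4Continuum.Support.MinimalActionLevels
import HarnessLib

/-!
# NE7TangentTransportTop — THE GAUGE-CORRECTED TEST-FIELD TRANSPORT (TT) OF (APE) AT AN ARBITRARY TOP AVERAGE: F52's identity
# WITHOUT the flat-top normalisation `cavgIter L (k+1) U = 1`, the exact defect it leaves, and its price `2·d·ω·C_fr·c_R`

Cell `pub-balaban`, rung (B)+1 sub-cell t4, lineage `b2b-balaban-t4-ne7-p2` (CRUX PROVER NE7 #2 = co-owner of row NE7), generation 85; module (153).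
A sibling of the OWNER's F52 `NE7TangentTransportGauge` (t4-ne7-p1 gen 71) over the SAME parents, answering the NE7 pricing desk's Q-59-1 ∕ road (α′)
(PRICING-NE7 v59 §419 (d): «re-prove F52 §2–§3 at a PURE-GAUGE top») with a NUMBER: what F52's gauge correction costs when the top single-bar average
`W_top := cavgIter L (k+1) U` is NOT the flat configuration.
WHY.  F52 §2 proves, under `hflatTop : cavgIter L (k+1) U = 1` and `D_1 Y = 0`, the EXACT identity `D_U(Y + gaugeDir_U λ) = Q̄_U Y − Q̄_1 Y` for the
corner lift `λ` of `F_1 Y − F_U Y`; F53 ∕ the END F54 carry `hflatTop` for that reason, and the desk books `hflatTop` as «a displayed normalisation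
NARROWER than B8 Thm 2's output, unprinted as typed» (N-59-1).  THIS FILE drops `hflatTop`: by the same three tree identities (the covariant structure
theorem `dirIter_eq_QbarIter_add_gaugeDir`, `dirIter_gaugeDir`, `dirIter_add`) and the flat structure theorem,
  `D_U(Y + gaugeDir_U λ) (z, κ) = Q̄_U Y (z, κ) − Q̄_1 Y (z, κ) + (Ad_{W_top(z,κ)⁻¹} − 1)(F_1 Y (z))`                                    (§2)
EXACTLY — the defect is the commutator of the top bond variable with the accumulated FLAT frame potential `F_1 Y = framePot L (k+1) Y` at the
bond's base point; it vanishes iff the top acts trivially on `F_1 Y`, in particular at `W_top = 1` (F52).  Consequently (§3) the repaired (TT) holds at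
ANY top that is `ω`-close to the identity (`‖W_top(z,κ) − 1‖ ≤ ω`), with the first-variation cost
  `|dAction U (Y′ − Y)| ≤ c_R·(Λ + 2·d·ω·C_F)·‖Y‖_{ℓ¹(periodBox T)}`,
where `C_F` is any `ℓ¹` letter `Σ_{z∈[0,N)^d} ‖F_1 Y (z)‖ ≤ C_F·‖Y‖_{ℓ¹}` for the flat frame potential — DISCHARGED for `d ≥ 2`, `L ≥ 2` by this lineage's
(139) `NE7FlatSliceStraightReduction.sum_norm_framePot_le` with the `k`- and `N`-free constant `C_fr(d, L) = 2·(dL)·(2dL+1)^d` (§4).  So the flat-top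
clause of the END can be REPLACED by the quantified letter «`‖cavgIter L (k+1) Ũ − 1‖_∞ ≤ ω`» at the displayed price `2·d·C_fr·ω·c_R` added to F52's
`c_R·Λ`; in the END's currency (`c_R = a·C·M^{d−2}`, `Λ = O(α̂M^{1−d})`, `τ ∼ M⁻³`) the new term is of the order of `τ` iff `ω ≲ α̂·M^{1−d}` — the
desk prices that; this file asserts no smallness of any top.
WHAT ([folklore]; 0 def, 0 sorry; the parents are F52's plus (139)).
§1 `gaugeDir_eq_neg_dPot_add` — `gaugeDir W G (z, κ) = −dPot G (z, κ) + (Ad_{W(z,κ)⁻¹} G(z) − G(z))`; `norm_Ad_inv_sub_le` — for a unitary bond variable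
   `‖Ad_{w⁻¹} X − X‖ ≤ 2‖w − 1‖·‖X‖`.
§2 **`dirIter_add_gaugeDir_eq_Qbar_sub_add_defect`** — the identity displayed above, NO top normalisation.
§3 **`tangent_transport_top`** — THE REPAIRED (TT) AT AN `ω`-SMALL TOP: F52 §3's data with `hflatTop` replaced by `hTop : ∀ z κ, ‖W_top(z,κ) − 1‖ ≤ ω` and a
   displayed `ℓ¹` frame letter `C_F`; conclusion `∃ Y′` skew periodic TANGENT AT `U` with `|dAction U (Y′ − Y) (perWin)| ≤ c_R·(Λ + 2·d·ω·C_F)·dirL1 Y (periodBox T)`.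
§4 **`tangent_transport_top_Cfr`** — the same with `C_F := C_fr(d, L)` from (139), for `2 ≤ d`, `2 ≤ L`.
§5 `norm_cavgIter_gaugeAct_sub_one_eq` ∕ **`tangent_transport_gaugeRep_Cfr`** — for the representative `Ũ = U^u` of a flat-top background the top
   letter is the coarse corner oscillation of the gauge, `‖u(Mz)·u(M(z+e_κ))⁻¹ − 1‖ ≤ ω` (`cavgIter_gaugeAct`); `hflatTop` for `Ũ` = `u|_{corners}` constant.
HONEST FRAMING (page 1): lattice kinematics + the exact gauge invariance of the first variation (`dAction_gaugeDir`), over tree identities; `R`, `Λ`, `ω`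
are HYPOTHESES (no smallness of any top average is proved or claimed); at `ω = 0` §3 is F52 §3 (not restated under its name); the (A)-bill's REP♭ line
and THE END are the OWNER's; (APE) NOT proved; NOT ONE-STEP, NOT NE7; spine 0∕9; finite T⁴ rung (B)+1 — NOT infinite volume, NOT mass gap, NOT Clay.
Continuum YM on T⁴ ⇐ BetaPertH ∧ nine spine estimates (0/9 proved); BetaPertH ⇐ (D1) ∧ (D4) ∧ CAP+tail; G-an2-4 gates asym, D1 and NE2/3/4.
-/

set_option autoImplicit false

open scoped BigOperators Matrix.Norms.L2Operator
open NormedSpace Finset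

namespace Summit.QuantumFields.BalabanUV.T4Continuum.NE7TangentTransportTop

open Literature.MathematicalPhysics.QuantumFieldTheory.Balaban1983to89
open B7Prop1Explicit B7Prop2Explicit MatrixLog UnitaryModel
open T4AveragingDeficitWall (IsUnitaryCfg IsSkewDir SmallField Ad curl fhol dirL1 flat_mem_classes)
open T4AveragingDeficitWallBoundary (IsPeriodicCfg periodBox)
open AveragingDeficitPeriodicCounting (IsPeriodicDir)
open AveragingDeficitChartCalculus (cavg)
open AveragingDeficitMultiLevelPrep (cpush cavgIter LevelSmall tower natCast_tower_succ isPeriodicDir_cpush cavgIter_unitary_small)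
open AveragingDeficitMultiLevelBridge (tower_eq)
open AveragingDeficitFermat (isPeriodicCfg_cavg)
open AveragingDeficitNearIdentity (norm_Ad_sub_le)
open AveragingDeficitTransport (mem_U1_of_unitary)
open MinimalActionLevels (perWin)
open BlockAveragePushDirGauge (gaugeDir isPeriodicDir_gaugeDir)
open BlockAveragePushDirSplit (flat)
open SmoothRefineNeutral (Tcoarse)
open NE3TangentNoGoWords (dPot)
open NE3TangentFlatStructure (Qcoarse framePot framePot_add_period iterate_Tcoarse_eq_zero_iff)
open NE3TangentCovariantTower (dirIter QbarIter framePotW dirIter_succ dirIter_one cavgIter_succ step_small dirIter_add dirIter_gaugeDir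
  dirIter_eq_QbarIter_add_gaugeDir dirIter_flat QbarIter_flat framePotW_flat gaugeDir_flat cavgIter_flat)
open NE3CurvedFrameKill (framePotW_skew_periodic pow_succ_mul_eq_tower)
open NE3LandauOrbit (gaugeDir_skew)
open NE3QuadRemainderTower (cpush_skew)
open NE3ResidualSliceRep (dirIter_sub)
open NE3HessForm (dAction)
open NE3PureGaugeFirstVariation (dAction_gaugeDir curl_add)
open NE7TangentTransportGauge (dAction_sub' dirIter_skew_periodic cornerLift_smul cornerLift_add_period)
open NE7FlatSliceStraightReduction (Cfr sum_norm_framePot_le)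

noncomputable section

variable {d : ℕ} {n : Type*} [Fintype n] [DecidableEq n]

local notation "𝕄" => Matrix n n ℂ

/-! ## §1 The gauge direction at an arbitrary configuration versus the flat one -/

/-- `gaugeDir W G (z, κ) = −dPot G (z, κ) + (Ad_{W(z,κ)⁻¹} G(z) − G(z))`: the gauge direction at `W` is the flat one (`gaugeDir_flat`) plus the
commutator defect of the bond variable with the generator at the base point. [folklore] -/
theorem gaugeDir_eq_neg_dPot_add (W : Site d → Fin d → 𝕄ˣ) (G : Site d → 𝕄) (z : Site d) (κ : Fin d) :
    gaugeDir W G z κ = -dPot G z κ + (Ad (W z κ)⁻¹ (G z) - G z) := by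
  simp only [gaugeDir, dPot]
  abel

/-- For a unitary bond variable `w`: `‖Ad_{w⁻¹} X − X‖ ≤ 2‖w − 1‖·‖X‖`. [folklore] -/
theorem norm_Ad_inv_sub_le [Nonempty n] {w : 𝕄ˣ} (hw : w ∈ unitaryUnits 𝕄) (X : 𝕄) :
    ‖Ad w⁻¹ X - X‖ ≤ 2 * ‖(w : 𝕄) - 1‖ * ‖X‖ := by
  have hwi : w⁻¹ ∈ unitaryUnits 𝕄 := (unitaryUnits 𝕄).inv_mem hw
  have h1 := norm_Ad_sub_le hwi X
  have h2 : ‖((w⁻¹ : 𝕄ˣ) : 𝕄) - 1‖ ≤ ‖(w : 𝕄) - 1‖ := norm_inv_sub_one_le (mem_U1_of_unitary hw)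
  calc ‖Ad w⁻¹ X - X‖ ≤ 2 * ‖((w⁻¹ : 𝕄ˣ) : 𝕄) - 1‖ * ‖X‖ := h1
    _ ≤ 2 * ‖(w : 𝕄) - 1‖ * ‖X‖ := by gcongr

/-! ## §2 F52's identity WITHOUT the flat-top normalisation: the exact defect -/

/-- **`D_U(Y + gaugeDir_U λ) = Q̄^{(k+1)}_U Y − Q^{(k+1)}_1 Y + (Ad_{W_top⁻¹} − 1) F_1 Y`** for the corner lift `λ` of
`framePot L (k+1) Y − framePotW L (k+1) U Y`, when `Y` is tangent at the flat background (`dirIter L (k+1) 1 Y = 0`) — F52 §2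
(`NE7TangentTransportGauge.dirIter_add_gaugeDir_eq_Qbar_sub`) with NO hypothesis on the top average `W_top := cavgIter L (k+1) U`; the defect is the
commutator of the top bond variable with the flat accumulated frame potential at the bond's base point, and vanishes at `W_top = 1`. [folklore] -/
theorem dirIter_add_gaugeDir_eq_Qbar_sub_add_defect [Nonempty n] {L N : ℕ} [NeZero N] (hL : 1 ≤ L) (k : ℕ)
    {U : Site d → Fin d → 𝕄ˣ} {x : ℝ} (hUu : IsUnitaryCfg U) (hUP : IsPeriodicCfg U ((tower L N (k + 1) : ℕ) : ℤ))
    (hx : 0 ≤ x) (hs : LevelSmall d L k x) (hUx : SmallField U x)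
    {Y : Site d → Fin d → 𝕄} (hY : IsSkewDir Y) (hYP : IsPeriodicDir Y ((tower L N (k + 1) : ℕ) : ℤ))
    (hYT : dirIter L (k + 1) (flat (d := d) (n := n)) Y = 0) (z : Site d) (κ : Fin d) :
    dirIter L (k + 1) U (fun y μ => Y y μ
        + gaugeDir U (fun xx : Site d => (fun w => framePot L (k + 1) Y w - framePotW L (k + 1) U Y w) (fun i => xx i / ((L : ℤ) ^ (k + 1)))) y μ) z κ
      = QbarIter L (k + 1) U Y z κ - QbarIter L (k + 1) (flat (d := d) (n := n)) Y z κ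
        + (Ad (cavgIter L (k + 1) U z κ)⁻¹ (framePot L (k + 1) Y z) - framePot L (k + 1) Y z) := by
  have hm : ((L : ℤ) ^ (k + 1)) ≠ 0 := pow_ne_zero _ (by exact_mod_cast (show L ≠ 0 by omega))
  have htow : ((tower L N (k + 1) : ℕ) : ℤ) = (L : ℤ) ^ (k + 1) * (N : ℤ) := (pow_succ_mul_eq_tower L N k).symm
  -- the two frame potentials: skew and `N`-periodic
  set g : Site d → 𝕄 := fun w => framePot L (k + 1) Y w - framePotW L (k + 1) U Y w with hg
  obtain ⟨hFUs, hFUP⟩ := framePotW_skew_periodic (M := N) hL k hUu hUP hx hs hUx hY hYP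
  have hflatu : IsUnitaryCfg (flat (d := d) (n := n)) := (flat_mem_classes (d := d) (n := n) hx).1
  have hflatx : SmallField (flat (d := d) (n := n)) x := (flat_mem_classes (d := d) (n := n) hx).2
  have hflatP : IsPeriodicCfg (flat (d := d) (n := n)) ((tower L N (k + 1) : ℕ) : ℤ) := fun _ _ _ => rfl
  obtain ⟨hF1s', hF1P'⟩ := framePotW_skew_periodic (M := N) hL k hflatu hflatP hx hs hflatx hY hYP
  have hF1s : ∀ w, framePot L (k + 1) Y w ∈ skewAdjoint 𝕄 := fun w => by
    rw [← framePotW_flat hL (k + 1) Y]; exact hF1s' w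
  have hF1P : ∀ (w : Site d) (i : Fin d), framePot L (k + 1) Y (w + (N : ℤ) • e i) = framePot L (k + 1) Y w := fun w i => by
    rw [← framePotW_flat hL (k + 1) Y]; exact hF1P' w i
  have hgs : ∀ w, g w ∈ skewAdjoint 𝕄 := fun w => (skewAdjoint 𝕄).sub_mem (hF1s w) (hFUs w)
  have hgP : ∀ (w : Site d) (i : Fin d), g (w + (N : ℤ) • e i) = g w := fun w i => by simp only [hg, hF1P w i, hFUP w i]
  -- the corner lift
  set lam : Site d → 𝕄 := fun xx => g (fun i => xx i / ((L : ℤ) ^ (k + 1))) with hlam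
  have hlams : ∀ xx, lam xx ∈ skewAdjoint 𝕄 := fun xx => hgs _
  have hlamP : ∀ (y : Site d) (i : Fin d), lam (y + ((tower L N (k + 1) : ℕ) : ℤ) • e i) = lam y := fun y i => by
    rw [htow]; exact cornerLift_add_period g hm hgP y i
  have hlam_corner : (fun y : Site d => lam (((L : ℤ) ^ (k + 1)) • y)) = g := by
    funext y; exact cornerLift_smul g hm y
  -- the three tree identities
  have hadd := dirIter_add hL k hUu hx hs hUx Y (gaugeDir U lam)
  have hgauge := dirIter_gaugeDir (M := N) hL k hUu hUP hx hs hUx hlams hlamP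
  have hstr := dirIter_eq_QbarIter_add_gaugeDir (M := N) hL k hUu hUP hx hs hUx hY hYP
  -- the flat structure theorem for the tangent `Y`
  have hQ1 : (Qcoarse L)^[k + 1] Y = dPot (framePot L (k + 1) Y) := by
    rw [← iterate_Tcoarse_eq_zero_iff hL (k + 1) Y, ← dirIter_flat hL (k + 1) Y]; exact hYT
  -- assemble pointwise
  have h1 := congr_fun (congr_fun hadd z) κ
  have h2 := congr_fun (congr_fun hgauge z) κ
  have h3 := congr_fun (congr_fun hstr z) κ
  rw [h1, h2, h3, hlam_corner, QbarIter_flat hL (k + 1) Y, hQ1]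
  simp only [gaugeDir, dPot, hg, Ad, mul_sub, sub_mul]
  abel

/-! ## §3 THE REPAIRED TEST-FIELD TRANSPORT AT AN `ω`-SMALL TOP -/

/-- **THE GAUGE-CORRECTED TEST-FIELD TRANSPORT (TT) OF (APE) AT AN ARBITRARY TOP.**  F52 §3's data (`L ≥ 1`, `N ≥ 1`, `k` levels, fine period
`T = L^{k+1}·N`; `U` unitary `T`-periodic in the multi-level class; an abstract right inverse `R` of `D_U` on skew `N`-periodic coarse data, exact,
with skew `T`-periodic values and the first-variation bound `c_R`; the straight-tower letter `Λ` of F50∕F51), WITH `hflatTop` REPLACED BY the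
displayed top letter `hTop : ‖cavgIter L (k+1) U (z, κ) − 1‖ ≤ ω` and an `ℓ¹` letter `C_F` for the flat accumulated frame potential
(`Σ_{z∈[0,N)^d} ‖framePot L (k+1) Y z‖ ≤ C_F·‖Y‖_{ℓ¹(periodBox T)}`, discharged in §4).  THEN every skew `T`-periodic `Y` tangent at the flat
background has a skew `T`-periodic `Y′` TANGENT AT `U` with `|dAction U (Y′ − Y) (perWin d T)| ≤ c_R·(Λ + 2·d·ω·C_F)·‖Y‖_{ℓ¹(periodBox T)}`:
`Y′ = Y + gaugeDir_U λ − R(D_U(Y + gaugeDir_U λ))` with §2's `λ`; the gauge part costs nothing (`dAction_gaugeDir`), the defect of §2 costs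
`2·d·ω·C_F` by `norm_Ad_inv_sub_le`.  At `ω = 0` this is F52 `tangent_transport_gauge`. [folklore] -/
theorem tangent_transport_top [Nonempty n] {L N : ℕ} [NeZero N] (hL : 1 ≤ L) (k : ℕ)
    {U : Site d → Fin d → 𝕄ˣ} {x : ℝ} (hUu : IsUnitaryCfg U) (hUP : IsPeriodicCfg U ((tower L N (k + 1) : ℕ) : ℤ))
    (hx : 0 ≤ x) (hs : LevelSmall d L k x) (hUx : SmallField U x)
    {ω : ℝ} (hω : 0 ≤ ω) (hTop : ∀ (z : Site d) (κ : Fin d), ‖((cavgIter L (k + 1) U z κ : 𝕄ˣ) : 𝕄) - 1‖ ≤ ω)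
    {CF : ℝ}
    (hF : ∀ Y : Site d → Fin d → 𝕄, IsSkewDir Y → IsPeriodicDir Y ((tower L N (k + 1) : ℕ) : ℤ) →
      ∑ z ∈ periodBox (d := d) N, ‖framePot L (k + 1) Y z‖ ≤ CF * dirL1 Y (periodBox (d := d) (tower L N (k + 1))))
    (R : (Site d → Fin d → 𝕄) → Site d → Fin d → 𝕄)
    (hRskew : ∀ φ : Site d → Fin d → 𝕄, IsSkewDir φ → IsPeriodicDir φ (N : ℤ) → IsSkewDir (R φ))
    (hRper : ∀ φ : Site d → Fin d → 𝕄, IsSkewDir φ → IsPeriodicDir φ (N : ℤ) →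
      IsPeriodicDir (R φ) ((tower L N (k + 1) : ℕ) : ℤ))
    (hRexact : ∀ φ : Site d → Fin d → 𝕄, IsSkewDir φ → IsPeriodicDir φ (N : ℤ) → dirIter L (k + 1) U (R φ) = φ)
    {cR : ℝ} (hcR : 0 ≤ cR)
    (hRbd : ∀ φ : Site d → Fin d → 𝕄, IsSkewDir φ → IsPeriodicDir φ (N : ℤ) →
      |dAction U (R φ) (perWin d (tower L N (k + 1)))| ≤ cR * dirL1 φ (periodBox (d := d) N))
    {Λ : ℝ}
    (hΛ : ∀ Y : Site d → Fin d → 𝕄, IsSkewDir Y → IsPeriodicDir Y ((tower L N (k + 1) : ℕ) : ℤ) →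
      ∑ z ∈ periodBox N, ∑ κ : Fin d, ‖QbarIter L (k + 1) U Y z κ - QbarIter L (k + 1) (flat (d := d) (n := n)) Y z κ‖
        ≤ Λ * dirL1 Y (periodBox (d := d) (tower L N (k + 1)))) :
    ∀ Y : Site d → Fin d → 𝕄, IsSkewDir Y → IsPeriodicDir Y ((tower L N (k + 1) : ℕ) : ℤ) →
      dirIter L (k + 1) (flat (d := d) (n := n)) Y = 0 →
      ∃ Y' : Site d → Fin d → 𝕄, IsSkewDir Y' ∧ IsPeriodicDir Y' ((tower L N (k + 1) : ℕ) : ℤ) ∧ dirIter L (k + 1) U Y' = 0 ∧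
        |dAction U (fun y μ => Y' y μ - Y y μ) (perWin d (tower L N (k + 1)))|
          ≤ cR * (Λ + 2 * d * ω * CF) * dirL1 Y (periodBox (d := d) (tower L N (k + 1))) := by
  intro Y hY hYP hYT
  have hm : ((L : ℤ) ^ (k + 1)) ≠ 0 := pow_ne_zero _ (by exact_mod_cast (show L ≠ 0 by omega))
  have htow : ((tower L N (k + 1) : ℕ) : ℤ) = (L : ℤ) ^ (k + 1) * (N : ℤ) := (pow_succ_mul_eq_tower L N k).symm
  -- the generator (as in §2) and its letters
  set g : Site d → 𝕄 := fun w => framePot L (k + 1) Y w - framePotW L (k + 1) U Y w with hg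
  set lam : Site d → 𝕄 := fun xx => g (fun i => xx i / ((L : ℤ) ^ (k + 1))) with hlam
  obtain ⟨hFUs, hFUP⟩ := framePotW_skew_periodic (M := N) hL k hUu hUP hx hs hUx hY hYP
  have hflatu : IsUnitaryCfg (flat (d := d) (n := n)) := (flat_mem_classes (d := d) (n := n) hx).1
  have hflatx : SmallField (flat (d := d) (n := n)) x := (flat_mem_classes (d := d) (n := n) hx).2
  have hflatP : IsPeriodicCfg (flat (d := d) (n := n)) ((tower L N (k + 1) : ℕ) : ℤ) := fun _ _ _ => rfl
  obtain ⟨hF1s', hF1P'⟩ := framePotW_skew_periodic (M := N) hL k hflatu hflatP hx hs hflatx hY hYP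
  have hgs : ∀ w, g w ∈ skewAdjoint 𝕄 := fun w => by
    have h1 : framePot L (k + 1) Y w ∈ skewAdjoint 𝕄 := by rw [← framePotW_flat hL (k + 1) Y]; exact hF1s' w
    exact (skewAdjoint 𝕄).sub_mem h1 (hFUs w)
  have hgP : ∀ (w : Site d) (i : Fin d), g (w + (N : ℤ) • e i) = g w := fun w i => by
    have h1 : framePot L (k + 1) Y (w + (N : ℤ) • e i) = framePot L (k + 1) Y w := by
      rw [← framePotW_flat hL (k + 1) Y]; exact hF1P' w i
    simp only [hg, h1, hFUP w i]
  have hlams : ∀ xx, lam xx ∈ skewAdjoint 𝕄 := fun xx => hgs _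
  have hlamP : ∀ (y : Site d) (i : Fin d), lam (y + ((tower L N (k + 1) : ℕ) : ℤ) • e i) = lam y := fun y i => by
    rw [htow]; exact cornerLift_add_period g hm hgP y i
  -- the gauge-corrected direction and its average
  set G : Site d → Fin d → 𝕄 := gaugeDir U lam with hG
  have hGs : IsSkewDir G := gaugeDir_skew hUu hlams
  have hGP : IsPeriodicDir G ((tower L N (k + 1) : ℕ) : ℤ) := isPeriodicDir_gaugeDir hUP hlamP
  set Y₁ : Site d → Fin d → 𝕄 := fun y μ => Y y μ + G y μ with hY₁
  have hY₁s : IsSkewDir Y₁ := fun y μ => (skewAdjoint 𝕄).add_mem (hY y μ) (hGs y μ)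
  have hY₁P : IsPeriodicDir Y₁ ((tower L N (k + 1) : ℕ) : ℤ) := fun y i μ => by simp only [hY₁, hYP y i μ, hGP y i μ]
  set ψ : Site d → Fin d → 𝕄 := dirIter L (k + 1) U Y₁ with hψ
  obtain ⟨hψs, hψP⟩ := dirIter_skew_periodic (M := N) hL k hUu hUP hx hs hUx hY₁s hY₁P
  -- the top is unitary, so the defect of §2 is `2ω`-small against the flat frame potential
  have hTopU : IsUnitaryCfg (cavgIter L (k + 1) U) := (cavgIter_unitary_small hL k hUu hx hs hUx).1
  have hψeq : ∀ (z : Site d) (κ : Fin d), ψ z κ = QbarIter L (k + 1) U Y z κ - QbarIter L (k + 1) (flat (d := d) (n := n)) Y z κ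
      + (Ad (cavgIter L (k + 1) U z κ)⁻¹ (framePot L (k + 1) Y z) - framePot L (k + 1) Y z) :=
    fun z κ => dirIter_add_gaugeDir_eq_Qbar_sub_add_defect hL k hUu hUP hx hs hUx hY hYP hYT z κ
  have hdef : ∀ (z : Site d) (κ : Fin d),
      ‖Ad (cavgIter L (k + 1) U z κ)⁻¹ (framePot L (k + 1) Y z) - framePot L (k + 1) Y z‖ ≤ 2 * ω * ‖framePot L (k + 1) Y z‖ := by
    intro z κ
    refine (norm_Ad_inv_sub_le (hTopU z κ) _).trans ?_
    have h0 : 0 ≤ ‖framePot L (k + 1) Y z‖ := norm_nonneg _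
    nlinarith [hTop z κ, norm_nonneg (((cavgIter L (k + 1) U z κ : 𝕄ˣ) : 𝕄) - 1)]
  -- the transported direction
  refine ⟨fun y μ => Y₁ y μ - R ψ y μ, ?_, ?_, ?_, ?_⟩
  · exact fun y μ => (skewAdjoint 𝕄).sub_mem (hY₁s y μ) (hRskew ψ hψs hψP y μ)
  · intro y i μ
    simp only [hY₁P y i μ, hRper ψ hψs hψP y i μ]
  · rw [dirIter_sub hL k hUu hx hs hUx Y₁ (R ψ), hRexact ψ hψs hψP]
    funext z κ
    simp [hψ]
  · -- dAction U (Y' − Y) = dAction U G − dAction U (R ψ) = −dAction U (R ψ)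
    have e1 : (fun y μ => (fun y μ => Y₁ y μ - R ψ y μ) y μ - Y y μ) = fun y μ => G y μ - R ψ y μ := by
      funext y μ; simp only [hY₁]; abel
    rw [e1, dAction_sub', hG, dAction_gaugeDir, zero_sub, abs_neg]
    refine (hRbd ψ hψs hψP).trans ?_
    -- the `ℓ¹` size of `ψ = Q̄_U Y − Q̄_1 Y + defect` on the coarse period box
    have hmain := hΛ Y hY hYP
    have hfr := hF Y hY hYP
    have h2 : 0 ≤ 2 * (d : ℝ) * ω := by positivity
    have hpt : ∀ z ∈ periodBox (d := d) N, ∑ κ : Fin d, ‖ψ z κ‖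
        ≤ (∑ κ : Fin d, ‖QbarIter L (k + 1) U Y z κ - QbarIter L (k + 1) (flat (d := d) (n := n)) Y z κ‖)
          + 2 * d * ω * ‖framePot L (k + 1) Y z‖ := by
      intro z _
      have hκ : ∀ κ : Fin d, ‖ψ z κ‖
          ≤ ‖QbarIter L (k + 1) U Y z κ - QbarIter L (k + 1) (flat (d := d) (n := n)) Y z κ‖ + 2 * ω * ‖framePot L (k + 1) Y z‖ := by
        intro κ
        rw [hψeq z κ]
        exact (norm_add_le _ _).trans (by linarith [hdef z κ])
      calc ∑ κ : Fin d, ‖ψ z κ‖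
          ≤ ∑ κ : Fin d, (‖QbarIter L (k + 1) U Y z κ - QbarIter L (k + 1) (flat (d := d) (n := n)) Y z κ‖
              + 2 * ω * ‖framePot L (k + 1) Y z‖) := Finset.sum_le_sum fun κ _ => hκ κ
        _ = (∑ κ : Fin d, ‖QbarIter L (k + 1) U Y z κ - QbarIter L (k + 1) (flat (d := d) (n := n)) Y z κ‖)
              + 2 * d * ω * ‖framePot L (k + 1) Y z‖ := by
            rw [Finset.sum_add_distrib, Finset.sum_const, Finset.card_univ, Fintype.card_fin, nsmul_eq_mul]
            ring
    have hsum : dirL1 ψ (periodBox (d := d) N)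
        ≤ (∑ z ∈ periodBox N, ∑ κ : Fin d, ‖QbarIter L (k + 1) U Y z κ - QbarIter L (k + 1) (flat (d := d) (n := n)) Y z κ‖)
          + 2 * d * ω * ∑ z ∈ periodBox (d := d) N, ‖framePot L (k + 1) Y z‖ := by
      have h := Finset.sum_le_sum hpt
      rw [Finset.sum_add_distrib, ← Finset.mul_sum] at h
      exact h
    have hψ1 : dirL1 ψ (periodBox (d := d) N) ≤ (Λ + 2 * d * ω * CF) * dirL1 Y (periodBox (d := d) (tower L N (k + 1))) :=
      calc dirL1 ψ (periodBox (d := d) N)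
          ≤ (∑ z ∈ periodBox N, ∑ κ : Fin d, ‖QbarIter L (k + 1) U Y z κ - QbarIter L (k + 1) (flat (d := d) (n := n)) Y z κ‖)
              + 2 * d * ω * ∑ z ∈ periodBox (d := d) N, ‖framePot L (k + 1) Y z‖ := hsum
        _ ≤ Λ * dirL1 Y (periodBox (d := d) (tower L N (k + 1)))
              + 2 * d * ω * (CF * dirL1 Y (periodBox (d := d) (tower L N (k + 1)))) :=
            add_le_add hmain (mul_le_mul_of_nonneg_left hfr h2)
        _ = (Λ + 2 * d * ω * CF) * dirL1 Y (periodBox (d := d) (tower L N (k + 1))) := by ring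
    calc cR * dirL1 ψ (periodBox (d := d) N) ≤ cR * ((Λ + 2 * d * ω * CF) * dirL1 Y (periodBox (d := d) (tower L N (k + 1)))) :=
          mul_le_mul_of_nonneg_left hψ1 hcR
      _ = cR * (Λ + 2 * d * ω * CF) * dirL1 Y (periodBox (d := d) (tower L N (k + 1))) := by ring

/-! ## §4 The `ℓ¹` frame letter discharged by (139): `C_F := C_fr(d, L)`, free of `k` and `N` -/

/-- **THE REPAIRED (TT) AT AN `ω`-SMALL TOP, WITH THE FRAME LETTER DISCHARGED** (`2 ≤ d`, `2 ≤ L`): §3 with `C_F := Cfr d L = 2·(dL)·(2dL+1)^d` from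
(139) `NE7FlatSliceStraightReduction.sum_norm_framePot_le`; cost `c_R·(Λ + 2·d·ω·C_fr(d,L))·‖Y‖_{ℓ¹(periodBox T)}`. [folklore] -/
theorem tangent_transport_top_Cfr [Nonempty n] (hd : 2 ≤ d) {L N : ℕ} [NeZero N] (hL : 2 ≤ L) (k : ℕ)
    {U : Site d → Fin d → 𝕄ˣ} {x : ℝ} (hUu : IsUnitaryCfg U) (hUP : IsPeriodicCfg U ((tower L N (k + 1) : ℕ) : ℤ))
    (hx : 0 ≤ x) (hs : LevelSmall d L k x) (hUx : SmallField U x)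
    {ω : ℝ} (hω : 0 ≤ ω) (hTop : ∀ (z : Site d) (κ : Fin d), ‖((cavgIter L (k + 1) U z κ : 𝕄ˣ) : 𝕄) - 1‖ ≤ ω)
    (R : (Site d → Fin d → 𝕄) → Site d → Fin d → 𝕄)
    (hRskew : ∀ φ : Site d → Fin d → 𝕄, IsSkewDir φ → IsPeriodicDir φ (N : ℤ) → IsSkewDir (R φ))
    (hRper : ∀ φ : Site d → Fin d → 𝕄, IsSkewDir φ → IsPeriodicDir φ (N : ℤ) →
      IsPeriodicDir (R φ) ((tower L N (k + 1) : ℕ) : ℤ))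
    (hRexact : ∀ φ : Site d → Fin d → 𝕄, IsSkewDir φ → IsPeriodicDir φ (N : ℤ) → dirIter L (k + 1) U (R φ) = φ)
    {cR : ℝ} (hcR : 0 ≤ cR)
    (hRbd : ∀ φ : Site d → Fin d → 𝕄, IsSkewDir φ → IsPeriodicDir φ (N : ℤ) →
      |dAction U (R φ) (perWin d (tower L N (k + 1)))| ≤ cR * dirL1 φ (periodBox (d := d) N))
    {Λ : ℝ}
    (hΛ : ∀ Y : Site d → Fin d → 𝕄, IsSkewDir Y → IsPeriodicDir Y ((tower L N (k + 1) : ℕ) : ℤ) →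
      ∑ z ∈ periodBox N, ∑ κ : Fin d, ‖QbarIter L (k + 1) U Y z κ - QbarIter L (k + 1) (flat (d := d) (n := n)) Y z κ‖
        ≤ Λ * dirL1 Y (periodBox (d := d) (tower L N (k + 1)))) :
    ∀ Y : Site d → Fin d → 𝕄, IsSkewDir Y → IsPeriodicDir Y ((tower L N (k + 1) : ℕ) : ℤ) →
      dirIter L (k + 1) (flat (d := d) (n := n)) Y = 0 →
      ∃ Y' : Site d → Fin d → 𝕄, IsSkewDir Y' ∧ IsPeriodicDir Y' ((tower L N (k + 1) : ℕ) : ℤ) ∧ dirIter L (k + 1) U Y' = 0 ∧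
        |dAction U (fun y μ => Y' y μ - Y y μ) (perWin d (tower L N (k + 1)))|
          ≤ cR * (Λ + 2 * d * ω * Cfr d L) * dirL1 Y (periodBox (d := d) (tower L N (k + 1))) := by
  have hL1 : 1 ≤ L := by omega
  have hN1 : 1 ≤ N := Nat.one_le_iff_ne_zero.mpr (NeZero.ne N)
  have htowN : tower L N (k + 1) = L ^ (k + 1) * N := by rw [tower_eq, Nat.mul_comm]
  have hF : ∀ Y : Site d → Fin d → 𝕄, IsSkewDir Y → IsPeriodicDir Y ((tower L N (k + 1) : ℕ) : ℤ) →
      ∑ z ∈ periodBox (d := d) N, ‖framePot L (k + 1) Y z‖ ≤ Cfr d L * dirL1 Y (periodBox (d := d) (tower L N (k + 1))) := by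
    intro Y _ hYP
    have hY' : ∀ (y : Site d) (τ μ : Fin d), Y (y + ((L ^ (k + 1) * N : ℕ) : ℤ) • e τ) μ = Y y μ := by
      intro y τ μ; rw [← htowN]; exact hYP y τ μ
    have h := sum_norm_framePot_le (n := n) hd hL hN1 (k + 1) hY'
    rwa [← htowN] at h
  exact tangent_transport_top hL1 k hUu hUP hx hs hUx hω hTop hF R hRskew hRper hRexact hcR hRbd hΛ

/-! ## §5 The top of a gauge representative over the trivial datum: `ω` is the coarse oscillation of the gauge at the block corners -/

/-- **WHAT `ω` IS FOR THE END's REPRESENTATIVE.**  If the background `U` has FLAT top single-bar average (`cavgIter L (k+1) U = 1`, the trivial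
datum) and `Ũ = U^u` for a unitary gauge transformation `u` (REP♭), then by the tree's covariance of the iterated average
(`NE3CpushGaugeCovariance.cavgIter_gaugeAct`) the top of `Ũ` is the PURE GAUGE of `u` sampled at the block corners,
`cavgIter L (k+1) Ũ (z, κ) = u(Mz)·u(M(z + e_κ))⁻¹` (`M = L^{k+1}`), so §3's top letter for `Ũ` reads
`‖u(Mz)·u(M(z+e_κ))⁻¹ − 1‖ ≤ ω` — the coarse nearest-corner oscillation of the gauge; `hflatTop` for `Ũ` is the case `u|_{corners}` constant
(PRICING-NE7 §419 (b)(1)). [folklore] -/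
theorem norm_cavgIter_gaugeAct_sub_one_eq [Nonempty n] {L : ℕ} (hL : 1 ≤ L) (k : ℕ)
    {U : Site d → Fin d → 𝕄ˣ} {x : ℝ} (hUu : IsUnitaryCfg U) (hx : 0 ≤ x) (hs : LevelSmall d L k x) (hUx : SmallField U x)
    (hflatTopU : cavgIter L (k + 1) U = flat)
    {u : Site d → 𝕄ˣ} (hu : ∀ y, u y ∈ unitaryUnits 𝕄) (z : Site d) (κ : Fin d) :
    ‖((cavgIter L (k + 1) (gaugeAct u U) z κ : 𝕄ˣ) : 𝕄) - 1‖
      = ‖(u (((L : ℤ) ^ (k + 1)) • z) : 𝕄) * ((u (((L : ℤ) ^ (k + 1)) • (z + e κ)))⁻¹ : 𝕄ˣ) - 1‖ := by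
  rw [NE3CpushGaugeCovariance.cavgIter_gaugeAct hL k hUu hx hs hUx hu, hflatTopU]
  simp only [gaugeAct, flat, mul_one, Units.val_mul, smul_add]

/-- Hence §4 for the representative `Ũ = U^u` of a flat-top background: the (TT) at `Ũ` with the top letter stated on the GAUGE,
`hcorner : ‖u(Mz)·u(M(z+e_κ))⁻¹ − 1‖ ≤ ω`. [folklore] -/
theorem tangent_transport_gaugeRep_Cfr [Nonempty n] (hd : 2 ≤ d) {L N : ℕ} [NeZero N] (hL : 2 ≤ L) (k : ℕ)
    {U : Site d → Fin d → 𝕄ˣ} {x : ℝ} (hUu : IsUnitaryCfg U) (hx : 0 ≤ x) (hs : LevelSmall d L k x) (hUx : SmallField U x)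
    (hflatTopU : cavgIter L (k + 1) U = flat)
    {u : Site d → 𝕄ˣ} (hu : ∀ y, u y ∈ unitaryUnits 𝕄)
    (hŨu : IsUnitaryCfg (gaugeAct u U)) (hŨP : IsPeriodicCfg (gaugeAct u U) ((tower L N (k + 1) : ℕ) : ℤ)) (hŨx : SmallField (gaugeAct u U) x)
    {ω : ℝ} (hω : 0 ≤ ω)
    (hcorner : ∀ (z : Site d) (κ : Fin d),
      ‖(u (((L : ℤ) ^ (k + 1)) • z) : 𝕄) * ((u (((L : ℤ) ^ (k + 1)) • (z + e κ)))⁻¹ : 𝕄ˣ) - 1‖ ≤ ω)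
    (R : (Site d → Fin d → 𝕄) → Site d → Fin d → 𝕄)
    (hRskew : ∀ φ : Site d → Fin d → 𝕄, IsSkewDir φ → IsPeriodicDir φ (N : ℤ) → IsSkewDir (R φ))
    (hRper : ∀ φ : Site d → Fin d → 𝕄, IsSkewDir φ → IsPeriodicDir φ (N : ℤ) →
      IsPeriodicDir (R φ) ((tower L N (k + 1) : ℕ) : ℤ))
    (hRexact : ∀ φ : Site d → Fin d → 𝕄, IsSkewDir φ → IsPeriodicDir φ (N : ℤ) → dirIter L (k + 1) (gaugeAct u U) (R φ) = φ)
    {cR : ℝ} (hcR : 0 ≤ cR)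
    (hRbd : ∀ φ : Site d → Fin d → 𝕄, IsSkewDir φ → IsPeriodicDir φ (N : ℤ) →
      |dAction (gaugeAct u U) (R φ) (perWin d (tower L N (k + 1)))| ≤ cR * dirL1 φ (periodBox (d := d) N))
    {Λ : ℝ}
    (hΛ : ∀ Y : Site d → Fin d → 𝕄, IsSkewDir Y → IsPeriodicDir Y ((tower L N (k + 1) : ℕ) : ℤ) →
      ∑ z ∈ periodBox N, ∑ κ : Fin d, ‖QbarIter L (k + 1) (gaugeAct u U) Y z κ - QbarIter L (k + 1) (flat (d := d) (n := n)) Y z κ‖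
        ≤ Λ * dirL1 Y (periodBox (d := d) (tower L N (k + 1)))) :
    ∀ Y : Site d → Fin d → 𝕄, IsSkewDir Y → IsPeriodicDir Y ((tower L N (k + 1) : ℕ) : ℤ) →
      dirIter L (k + 1) (flat (d := d) (n := n)) Y = 0 →
      ∃ Y' : Site d → Fin d → 𝕄, IsSkewDir Y' ∧ IsPeriodicDir Y' ((tower L N (k + 1) : ℕ) : ℤ) ∧ dirIter L (k + 1) (gaugeAct u U) Y' = 0 ∧
        |dAction (gaugeAct u U) (fun y μ => Y' y μ - Y y μ) (perWin d (tower L N (k + 1)))|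
          ≤ cR * (Λ + 2 * d * ω * Cfr d L) * dirL1 Y (periodBox (d := d) (tower L N (k + 1))) := by
  have hL1 : 1 ≤ L := by omega
  have hTop : ∀ (z : Site d) (κ : Fin d), ‖((cavgIter L (k + 1) (gaugeAct u U) z κ : 𝕄ˣ) : 𝕄) - 1‖ ≤ ω := by
    intro z κ
    rw [norm_cavgIter_gaugeAct_sub_one_eq hL1 k hUu hx hs hUx hflatTopU hu z κ]
    exact hcorner z κ
  exact tangent_transport_top_Cfr hd hL k hŨu hŨP hx hs hŨx hω hTop R hRskew hRper hRexact hcR hRbd hΛ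

end

end Summit.QuantumFields.BalabanUV.T4Continuum.NE7TangentTransportTop
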